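import Summits.QuantumFields.Balaban3D.Proofs.Inputs
import Summits.QuantumFields.Balaban3D.Proofs.Bound55Std
import Summits.QuantumFields.Balaban3D.Proofs.CouplingWindow

/-!
# Bałaban CMP 102 (1985), d = 3 lane — `Proofs.AlphaBound55`: the STEP BOUNDS (22)/(55)·(58) and their lower twin (rows C1 `bound55`,
# C2 `bound55Lower`) AT THE LANE'S PIECES `Inputs.pieces 𝔎 X 𝔖 k`, REDUCED to seat p4's hypotheses by APPLICATION of `Proofs.Bound55Std`
# at the unpinned tower (`Inputs.piecesW`) and TRANSPORT to the pinned one (`Inputs.bound55_pieces_of_unpinned`) — the barrier pinnings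
# (`rfl`, p1 `stdTowerInput_upper/_lower`), the threshold ordering `ε_L ≤ ε_S` ((7)/(40): `g_kp(g_k) ≤ 2L²g_{k−1}p(g_{k−1})`, ruling
# R-SEL (e) «⇒ p3») and `Rm_k ≥ 0` DISCHARGED here

Source: T. Bałaban, *Ultraviolet stability of three-dimensional lattice pure gauge field theories*, Commun. Math. Phys. **102** (1985)
255–275 [Balaban1985UV3] ([B10]; PDF page = journal page − 254): (7)–(8) p. 257, (22) p. 261, (40)–(41) p. 266, (47)–(49) pp. 267–268, (55)
p. 269, (58) p. 270, p. 272 L32–33.  Lane `pub-balaban3d`, seat p3 (assembly; LEAF-LEDGER C1/C2; rulings R-RN, R-SEL, R-FIBRE); the leaves are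
seat p4's `Bound55Std.bound55_std` / `bound55Lower_std`.

WHAT REMAINS AS HYPOTHESES after this file (LEAF-LEDGER §F): the lane's two booked (β) RESIDUALS R3D-01 `Bound55Std.Fibre49` («The integral
(49)» ≤ (55)·(58), per new history) and R3D-02 `Bound55Std.Fibre57Low` (the trivial-history lower bound, p. 265 L21–28 / p. 272 L32–33), and
the integrability of the (41)_k summands / the (47)_k left-hand side (`hint`, `hint47` — regularity of the expansion data `Pint` and of the
minimizers under the product Haar measure); the threshold ordering `hLS` is DISCHARGED (`eps1Of_le_epsSOf`).  Nothing of the paper is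
asserted.  No `sorry`.
-/

noncomputable section

namespace Summit.QuantumFields.Balaban3D.Proofs.AlphaBound55

open MeasureTheory
open Literature.MathematicalPhysics.QuantumFieldTheory.Balaban1983to89
open Literature.MathematicalPhysics.QuantumFieldTheory.Balaban1983to89.B10
open Literature.MathematicalPhysics.QuantumFieldTheory.Balaban1983to89.B10SectAGathering
open Literature.MathematicalPhysics.QuantumFieldTheory.Balaban1985CMP102
open Literature.MathematicalPhysics.QuantumFieldTheory.Balaban1985CMP102.Setting
open Summit.QuantumFields.Balaban3D.Carriers
open Summit.QuantumFields.Balaban3D.Proofs.ScalesArithmetic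
open Summit.QuantumFields.Balaban3D.Proofs.Constants
open Summit.QuantumFields.Balaban3D.Proofs.Inputs
open Summit.QuantumFields.Balaban3D.Proofs.Bound55Std (Fibre49 Fibre57Low bound55_std bound55Lower_std)

variable {L : ℕ} (𝔎 : LaneConsts L) {S : Scales L} {G : Type} [GaugeGroup G] [MeasurableSpace G] [HaarData G]
  {V : Type} [NormedAddCommGroup V] [NormedSpace ℂ V]
  (X : ExternalInputs S G) (𝔖 : ∀ k, StepSeries S G V (nblkOf S 𝔎.carrier k) k) (k : ℕ)

/-! ## The threshold ordering `ε_L(k) ≤ ε_S(k)` of the decomposition of unity (ruling R-SEL (e)) and `Rm_k ≥ 0` -/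

/-- **`ε_L(k) = g_kp(g_k) ≤ 2L²g_{k−1}p(g_{k−1}) = ε_S(k)`** for `k ≤ K` ((7) p. 257 / (40) p. 266; the threshold ordering seat p4's
decomposition-of-unity covering needs, R-SEL (e)): `g_k = L^{1/2}g_{k−1} ≤ 2L²g_{k−1}` and `p` is decreasing on `(0, 1]` (seat p2's
`CouplingWindow.pFun_antitone`) with `g_{k−1} ≤ g_k ≤ 1` (`ScalesArithmetic.gk_mono`, `gk_le_one`); at `k = 0` both sides carry `g₀p(g₀)`.
[cite: Balaban1985UV3, (7) p.257 + (40) p.266] -/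
theorem eps1Of_le_epsSOf (K : CarrierConsts) (hb : 0 ≤ K.b₀) (hp : 0 ≤ K.p₀) (hk : k ≤ S.K) :
    eps1Of S K k ≤ epsSOf S K k := by
  unfold eps1Of epsSOf
  have hL1 : (1 : ℝ) ≤ L := by exact_mod_cast S.hL.2.le
  have hL2 : (1 : ℝ) ≤ 2 * (L : ℝ) ^ 2 := by nlinarith
  have hg0 : 0 < S.gk (k - 1) := gk_pos S (k - 1)
  have hgk : 0 < S.gk k := gk_pos S k
  have hgk1 : S.gk k ≤ 1 := gk_le_one S S.gK_le_one k hk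
  have hmono : S.gk (k - 1) ≤ S.gk k := gk_mono S (Nat.sub_le k 1)
  have hp1 : pFun K.b₀ K.p₀ (S.gk k) ≤ pFun K.b₀ K.p₀ (S.gk (k - 1)) :=
    CouplingWindow.pFun_antitone hb hp hg0 hmono hgk1
  have hpk : 0 ≤ pFun K.b₀ K.p₀ (S.gk k) := pFun_nonneg _ _ _ hb hgk hgk1
  have hp0 : 0 ≤ pFun K.b₀ K.p₀ (S.gk (k - 1)) := pFun_nonneg _ _ _ hb hg0 (hmono.trans hgk1)
  -- g_k ≤ L^{1/2} g_{k−1} ≤ 2L² g_{k−1}: from g_k² = L·g_{k−1}² (k ≥ 1) or equality (k = 0)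
  have hgL : S.gk k ≤ 2 * (L : ℝ) ^ 2 * S.gk (k - 1) := by
    rcases Nat.eq_zero_or_pos k with rfl | hkpos
    · simpa using le_mul_of_one_le_left hgk.le hL2
    · have hsq : S.gk k ^ 2 = (L : ℝ) * S.gk (k - 1) ^ 2 := by
        rw [gk_sq, gk_sq]
        obtain ⟨j, rfl⟩ : ∃ j, k = j + 1 := ⟨k - 1, by omega⟩
        simp only [Nat.add_sub_cancel, pow_succ]
        ring
      have hb2 : S.gk k ^ 2 ≤ (2 * (L : ℝ) ^ 2 * S.gk (k - 1)) ^ 2 := by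
        rw [hsq]
        have h4 : (L : ℝ) ≤ (2 * (L : ℝ) ^ 2) ^ 2 := by nlinarith
        calc (L : ℝ) * S.gk (k - 1) ^ 2 ≤ (2 * (L : ℝ) ^ 2) ^ 2 * S.gk (k - 1) ^ 2 :=
              mul_le_mul_of_nonneg_right h4 (sq_nonneg _)
          _ = (2 * (L : ℝ) ^ 2 * S.gk (k - 1)) ^ 2 := by ring
      have h := Real.sqrt_le_sqrt hb2
      rwa [Real.sqrt_sq hgk.le, Real.sqrt_sq (by positivity)] at h
  calc S.gk k * pFun K.b₀ K.p₀ (S.gk k)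
      ≤ (2 * (L : ℝ) ^ 2 * S.gk (k - 1)) * pFun K.b₀ K.p₀ (S.gk (k - 1)) :=
        mul_le_mul hgL hp1 hpk (by positivity)
    _ = 2 * (L : ℝ) ^ 2 * (S.gk (k - 1) * pFun K.b₀ K.p₀ (S.gk (k - 1))) := by ring

/-- **`Rm_k ≥ 0` for the lane's tower**: the booked remainder `Σ_{j<k} rcoef j·(L^jε)^{3+κ₀}|T₁^{(j)}|` has `rcoef j = rstar·g^{6+2κ₀} ≥ 0`.
[cite: Balaban1985UV3, (41) p.266] -/
theorem rm_nonneg : 0 ≤ (towerW 𝔎 X 𝔖).Rm k := by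
  show 0 ≤ ∑ j ∈ Finset.range k, (inputOf 𝔎 X 𝔖).rcoef j * ((L : ℝ) ^ j * S.ε) ^ (3 + (inputOf 𝔎 X 𝔖).κ₀) * S.sites j
  refine Finset.sum_nonneg fun j _ => ?_
  have hr : 0 ≤ (inputOf 𝔎 X 𝔖).rcoef j := by
    show 0 ≤ 𝔎.sc.rstar * S.g ^ ((6 : ℝ) + 2 * 𝔎.F.κ₀)
    exact mul_nonneg 𝔎.sc.rstar_nonneg (Real.rpow_nonneg S.g_pos.le _)
  exact mul_nonneg (mul_nonneg hr (Real.rpow_nonneg (pow_mul_eps_pos S j).le _)) (sites_nonneg S j)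

/-! ## C1 / C2 at the lane's pieces -/

/-- **Row C1 AT THE LANE'S PIECES** — (22) p. 261 / (55)·(58) pp. 269–270 (`Bound55 (pieces 𝔎 X 𝔖 k)`) from seat p4's `bound55_std` at the
unpinned pieces `piecesW` and the transport `bound55_pieces_of_unpinned`: hypotheses = the RESIDUAL R3D-01 `Fibre49` for every new history
and the integrability `hint` of the (41)_k summands; DISCHARGED: the step's threshold ordering `ε_L(k) ≤ ε_S(k)` (`eps1Of_le_epsSOf`, `k ≤ K`;
p4's `hLS` is per step since Bound55Std v2), the barrier pinnings (`rfl`: p1 `stdTowerInput_upper`/`_lower` — the pieces ARE p1's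
`seriesPieces` at `piecesParamsOf`), `Rm_k ≥ 0` (`rm_nonneg`).
[cite: Balaban1985UV3, (22) p.261 + (55) p.269 + (58) p.270] -/
theorem bound55_pieces [RegularGaugeGroup G] (hk : k + 1 ≤ S.K)
    (hint : ∀ h : Hist S.P k, Integrable (fun U => (inputOf 𝔎 X 𝔖).W.mass k h U *
      Real.exp (-((towerW 𝔎 X 𝔖).mainT k h U) + (inputOf 𝔎 X 𝔖).Pint k h U - (towerW 𝔎 X 𝔖).Ecst k
        + (towerW 𝔎 X 𝔖).Zterm k h + (towerW 𝔎 X 𝔖).Rm k)) (fieldMeasure S.P k G))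
    (hfibre : ∀ h' : Hist S.P (k + 1), Fibre49 X 𝔎.carrier 𝔖 (fun _ => True) k (piecesW 𝔎 X 𝔖 k) h') :
    Bound55 (pieces 𝔎 X 𝔖 k) :=
  bound55_pieces_of_unpinned 𝔎 X 𝔖 k
    (bound55_std X 𝔎.carrier 𝔖 (fun _ => True) k (piecesW 𝔎 X 𝔖 k)
      (eps1Of_le_epsSOf k 𝔎.carrier 𝔎.F.b₀_nonneg 𝔎.F.p₀_pos.le (by omega)) hint hfibre (fun _ => rfl) (fun _ => rfl)
      (rm_nonneg 𝔎 X 𝔖 k))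

/-- **Row C2 AT THE LANE'S PIECES** — the lower twin (`Bound55Lower (pieces 𝔎 X 𝔖 k)`; p. 265 L21–28 / p. 272 L32–33) from seat p4's
`bound55Lower_std` at `piecesW` and `bound55Lower_pieces_of_unpinned`: hypotheses = the RESIDUAL R3D-02 `Fibre57Low` and the integrability
`hint47` of the (47)_k left-hand side; the lower-barrier pinning is `rfl`. [cite: Balaban1985UV3, p.265 L21–28 + (47) p.267 + p.272 L32–33] -/
theorem bound55Lower_pieces [RegularGaugeGroup G]
    (hint47 : Integrable (fun U => (towerW 𝔎 X 𝔖).chi k U *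
      Real.exp (-((towerW 𝔎 X 𝔖).mainT k (Hist.triv S.P k) U) + (inputOf 𝔎 X 𝔖).Pint k (Hist.triv S.P k) U
        - (towerW 𝔎 X 𝔖).Ecst k - (towerW 𝔎 X 𝔖).Rm k)) (fieldMeasure S.P k G))
    (hfibreLow : Fibre57Low X 𝔎.carrier 𝔖 (fun _ => True) k (piecesW 𝔎 X 𝔖 k)) :
    Bound55Lower (pieces 𝔎 X 𝔖 k) :=
  bound55Lower_pieces_of_unpinned 𝔎 X 𝔖 k
    (bound55Lower_std X 𝔎.carrier 𝔖 (fun _ => True) k (piecesW 𝔎 X 𝔖 k) hint47 hfibreLow (fun _ => rfl))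

end Summit.QuantumFields.Balaban3D.Proofs.AlphaBound55

end
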